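import Summits.QuantumFields.YangMills.Theorems.BalabanUVNodesPortS1Sect5GaugeOn
import Literature.MathematicalPhysics.QuantumFieldTheory.Balaban1983to89.Node00.Record13SepCoPHChi

/-!
# NODE N09 ([Balaban1987RG1] Thm 3 p.264) AT THE RE-CENTRED («Ax») STAGE-13 RECORD, ON THE SMALL-FIELD DOMAINS — the Theorem-3 member `smallCouplings → smallFieldInductive` at a world bound
# to `(datumOfRecord₁₃SepCoPHAx θ h).C`: dag-n09-w4's on-domains core (`…N09AtRecord13SepCoPHOnDomains` §3) re-issued with the axial-gauge-invariant cut-off `chiβOfRecord₁₃Ax`, AND (M1-dom) DISCHARGED —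
# at the re-centred record the lift-invariance of the cut-off over the domains is a THEOREM (node00-def-Y [Ax-2] `chiFixed29Ax_gaugeAct_liftTransf`; port lane `…PortS1Sect5GaugeOn` §1), so NO
# covariance ∕ axiality row (`haxDom`, `haxbg`, `cd`) is displayed

TRACK A (YM-PLAN §2d), seat `pub-ymgap-dag-n24-c` (gen 23; K1ᴬ engine-lane hand, helper lane `--supports stmt-QuantumFields-27239`, count-neutral).  [I] = [Balaban1987RG1]; [B11] = [Balaban1985Variational].

WHY.  The Ax K1 engine ✓p811182 ∕ face ✓p811320 (edition «N09T-free») display N09's Theorem-3 MEMBER `h09T` at the re-centred record because dag-n09-w2's door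
`…N09AxialCovariance181OnDomainsReg8Nesting.thm3Member_forall_stage13SepCoPH_onDomains_of_axialOn_of_reg8_of_suppPt` has no Ax edition.  That door = dag-n09-w4's ON-DOMAINS CORE
(`…N09AtRecord13SepCoPHOnDomains.thm3Member_stage13SepCoPH_onDomains`: rows (M1-dom), (F7a-dom), (I19), [B11] ×3, nesting) + the CHOICE-centred covariance transport (`…N09AxialCovariance181*`:
(M1-dom) from axial gauge of the CHOSEN critical configuration + unique orbits — rows `haxDom ∕ haxbg ∕ cd`) + the nesting suppliers (`…FluctNesting ∕ …HeredModFineOfThm1 ∕ …NestingOfHierAxial`).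
At the RE-CENTRED record the first two collapse: (i) the core is χ-GENERIC but for NODE 00's two faces `flow ∕ IndAss` of the datum, which hold for def-Y's `datumOfRecord₁₃SepCoPHAx` by the same
`rfl ∕ Iff.rfl` (§0); (ii) (M1-dom) for `chiβOfRecord₁₃Ax` needs NO axiality: [Ax-2] `chiFixed29Ax_gaugeAct_liftTransf` from [B11] Thm 1 at the cut-off's radius `θ.ν.εreg` on the domains
(the port lane's `chiβOfRecord₁₃Ax_gaugeAct_liftTransf_ae_on`, cited by name).  THIS FILE types (i) and (ii): §1 the core at the Ax record (rows as dag-n09-w4's, σ = `chiβOfRecord₁₃ ∕ gOfRecord₁₃ ∕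
betaOfRecord₁₃ ∕ datumOfRecord₁₃SepCoPH ∕ Provisos₁₃SepCoPH ↦ …Ax`; proof = his, over his χ-generic §1–§2 engine BY NAME); §2 the `∀ P` form; §3 ★ the Ax door v1 `…_of_thm1reg`: (M1-dom) GONE,
displayed = (F7a-dom) a.e. `hχreg`, (I19) `hint`, [B11] Thm 1 ×3 at `θ.εbg` (`h11 ∕ hres ∕ huniq`) AND at the cut-off radius `θ.ν.εreg` on the domains (`h11reg`), the nesting `hnestreg`;
§4 the engine's `h09T` shape from §3 (`γ₉ := 1`, the window letter idle).  What is NOT here (v2, N09's lane): the nesting row derived from the pointwise (F7a), hierarchical axiality of the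
background averages, `reg8` and the [B7]-numerics (dag-n09-w1 g2's `hnestreg_of_suppPt_of_hierAxial_of_reg8` reads `chiFix29OfRecord = 1` near the CHOSEN critical configuration —
`…FluctNesting.chiFix29OfRecord_eq_one_of_critCfg_eq` — whose Ax twin wants n07-w3's `critCfgAxOfRecord` clauses), and (F7a-dom) a.e. from its pointwise form (one `Filter.Eventually.of_forall`, kept displayed a.e. here as in the core).

WHAT (5 theorems, 0 `def`, 0 `sorry`; standard axioms): §0 `flow_stage13SepCoPHAx` (`rfl`) · `indAss_stage13SepCoPHAx_iff` (`Iff.rfl`) · §1 `thm3Member_stage13SepCoPHAx_onDomains` · §2 `thm3Member_forall_stage13SepCoPHAx_onDomains` ·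
§3 ★ `thm3Member_forall_stage13SepCoPHAx_onDomains_of_thm1reg` · §4 `h09T_recordAx_of_rows` (the Ax engine's `h09T` member shape at any `(θ, h)`).

HONEST FRAMING.  Composition BY NAME (dag-n09-w4's χ-generic engine, K0e's canonical-transport step, def-Y's [Ax-2], the port lane's (M1-dom)); count-neutral; (F7a-dom), (I19), [B11] ×3 (+ at
`εreg`) and the nesting are DISPLAYED hypotheses, located in print, none asserted; NO estimate of Bałaban's proved; N09 NOT discharged; K0ᴬ ∕ K1ᴬ OPEN; one finite 𝕋⁴ programme at fixed
`ε = L^{−K}` — NOT continuum ∕ ℝ⁴ ∕ OS ∕ mass gap ∕ Clay.  THEOREMS ONLY, standard axioms.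
-/

noncomputable section

namespace Summit.QuantumFields.YangMills.BalabanUVNodes.N09AtRecord13SepCoPHAxOnDomains

open MeasureTheory Set
open Literature.MathematicalPhysics.QuantumFieldTheory.Balaban1983to89
open Literature.MathematicalPhysics.QuantumFieldTheory.Balaban1983to89.T4Continuum (T4Family)
open Literature.MathematicalPhysics.QuantumFieldTheory.Balaban1983to89.DagBinding (WorldP leavesP)
open Literature.MathematicalPhysics.QuantumFieldTheory.Balaban1983to89.Node00
open Literature.MathematicalPhysics.QuantumFieldTheory.Balaban1983to89.FlowStep (HBeta prefixOf)
open Literature.MathematicalPhysics.QuantumFieldTheory.Balaban1983to89.FlowStepRuns (genSeq genFlow)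
open Literature.MathematicalPhysics.QuantumFieldTheory.Balaban1983to89.B12RTGaugeInvariance254 (liftTransf)
open Literature.MathematicalPhysics.QuantumFieldTheory.Balaban1983to89.GaugeField (gaugeAct)
open Literature.MathematicalPhysics.QuantumFieldTheory.Balaban1983to89.B12ContinuousTransportInvarianceOn (isOpen_domAltOfRecord)
open Summit.QuantumFields.YangMills.BalabanUVNodes.N09AtRecord13SepCoPHOnDomains (thm3Member_of_indATPlug_of_stepsOn_on stepOn_TβOfRecord₁₃_of_subset_regSet_inter_of_on
  domAltOfRecord_gaugeAct_mem_iff)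
open Summit.QuantumFields.YangMills.Theorems.BalabanUVNodesPortS1 (chiβOfRecord₁₃Ax_gaugeAct_liftTransf_ae_on)

variable {F : T4Family} {N : ℕ} [NeZero N]

/-! ## §0. The two faces of def-Y's re-centred Stage-13 `SepCoPH` datum N09 reads (`rfl` ∕ `Iff.rfl`, as `B12NodeKnitRecord13SepCoPH` §0 at the centred record) -/

variable (F N) in
/-- FACE flow AT THE RE-CENTRED STAGE-13 RECORD: every run's flow is generated forward by (0.20) with `betaOfRecord₁₃Ax θ` (`rfl`). [cite: Balaban1987RG1, (0.17)–(0.20) pp.255–256 (bookkeeping)] -/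
theorem flow_stage13SepCoPHAx (θ : Stage13HParams F N) (h : θ.Provisos₁₃SepCoPHAx F N) (p : B12.RunParams) :
    ((datumOfRecord₁₃SepCoPHAx F N θ h).C p).flow = genFlow (betaOfRecord₁₃Ax F N θ.toStage13Params) p.g0 := rfl

variable (F N) in
/-- FACE `IndAss` AT THE RE-CENTRED STAGE-13 RECORD: the clause IS `IndAOfRecordT` at the canonical-version transport `TβOfRecord₁₃` and the RE-CENTRED (2.9) cut-off `chiβOfRecord₁₃Ax θ`, read at the
generated history and the record's own objects (`Iff.rfl`). [cite: Balaban1987RG1, (1.1)–(1.6) pp.260–261, (2.9) p.266 and Thm 3 p.264 (bookkeeping)] -/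
theorem indAss_stage13SepCoPHAx_iff (θ : Stage13HParams F N) (h : θ.Provisos₁₃SepCoPHAx F N) (p : B12.RunParams) (k : ℕ) :
    ((datumOfRecord₁₃SepCoPHAx F N θ h).C p).IndAss k ↔
      IndAOfRecordT F N (TβOfRecord₁₃ F N) (chiβOfRecord₁₃Ax F N θ.toStage13Params) θ.εbg (betaOfRecord₁₃Ax F N θ.toStage13Params) p k
        (prefixOf (genSeq (betaOfRecord₁₃Ax F N θ.toStage13Params) p.g0) k) (domAltOfRecord F N θ.ν p.K k)
        (effActionOfRecordT F N (TβOfRecord₁₃ F N) (chiβOfRecord₁₃Ax F N θ.toStage13Params) (betaOfRecord₁₃Ax F N θ.toStage13Params) p k)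
        (wilsonBGOfRecord F N θ.εbg p k)
        (EkOfRecordT F N (TβOfRecord₁₃ F N) (chiβOfRecord₁₃Ax F N θ.toStage13Params) θ.εbg (betaOfRecord₁₃Ax F N θ.toStage13Params) p k) := Iff.rfl

/-! ## §1–§2. dag-n09-w4's on-domains core at the re-centred record: `S_{j+1} := domAltOfRecord θ.ν K (j+1)`, `D_{j+1} := regSetOfRecord K j ρ_j ∩ S_{j+1}`, `ρ_j` over `chiβOfRecord₁₃Ax` -/

/-- **THE THEOREM-3 MEMBER AT THE RE-CENTRED STAGE-13 CONSTRUCTION ON THE SMALL-FIELD DOMAINS**: for `w.C = (datumOfRecord₁₃SepCoPHAx θ h).C` and a run `P`, `smallCouplings → smallFieldInductive`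
follows from — (M1-dom) «`χ^{Ax}_j(U^{v∘blockOf}) = χ^{Ax}_j(U)` for `dU`-a.e. `U` with `Ū ∈ domAltOfRecord θ.ν K (j+1)`»; (F7a-dom) «for `dU`-a.e. `U` with `Ū ∈ domAltOfRecord θ.ν K (i+2)`:
`U ∉ regSetOfRecord K i ρ_i ∩ domAltOfRecord θ.ν K (i+1) ⇒ χ^{Ax}_{i+1}(U) = 0`»; (I19) integrability of the (0.19) densities met; [B11] Thm 1's three binders on the record's domains; and the
NESTING «`Ū^{i+1}(U_k V) ∈ regSetOfRecord K i ρ_i ∩ domAltOfRecord θ.ν K (i+1)`».  dag-n09-w4's `thm3Member_of_indATPlug_of_stepsOn_on` at `T' := TβOfRecord₁₃`, `χ := chiβOfRecord₁₃Ax θ`,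
`ε := θ.εbg`, `β := betaOfRecord₁₃Ax θ`, fed by §0's faces, the cut-off's flow-blindness (`rfl`) and his §2 step — his proof byte for byte under σ.  CONDITIONAL; nothing of Bałaban asserted; N09 NOT discharged.
[cite: Balaban1987RG1, Thm 3 p.264, (1.1)–(1.3) p.260, (0.13) p.254, p.256, p.259, p.263, (2.1) p.265, (2.9)–(2.10) pp.266–267, (2.16) p.269; Balaban1985Variational, Thm 1 (8)–(10) p.279] -/
theorem thm3Member_stage13SepCoPHAx_onDomains (θ : Stage13HParams F N) (h : θ.Provisos₁₃SepCoPHAx F N) {w : WorldP}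
    (hC : w.C = (datumOfRecord₁₃SepCoPHAx F N θ h).C) (P : B12.RunParams)
    (hχinv : ∀ j < P.K, ∀ v : GaugeTransf (F.P P.K) (j + 1) (SU N), ∀ᵐ U ∂(fieldMeasure (F.P P.K) j (SU N)),
      (avOfRecord F N P.K j).avg U ∈ domAltOfRecord F N θ.ν P.K (j + 1) →
        chiβOfRecord₁₃Ax F N θ.toStage13Params P.K (gOfRecord₁₃Ax F N θ.toStage13Params P) j (gaugeAct (liftTransf v) U) =
          chiβOfRecord₁₃Ax F N θ.toStage13Params P.K (gOfRecord₁₃Ax F N θ.toStage13Params P) j U)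
    (hχreg : ∀ i, i + 1 < P.K → ∀ᵐ U ∂(fieldMeasure (F.P P.K) (i + 1) (SU N)),
      (avOfRecord F N P.K (i + 1)).avg U ∈ domAltOfRecord F N θ.ν P.K (i + 2) →
        U ∉ regSetOfRecord F N P.K i (betaInputOfRecord F N (TβOfRecord₁₃ F N) (chiβOfRecord₁₃Ax F N θ.toStage13Params) P.K (gOfRecord₁₃Ax F N θ.toStage13Params P) i) ∩
            domAltOfRecord F N θ.ν P.K (i + 1) →
          chiβOfRecord₁₃Ax F N θ.toStage13Params P.K (gOfRecord₁₃Ax F N θ.toStage13Params P) (i + 1) U = 0)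
    (hint : ∀ j < P.K, Integrable (betaInputOfRecord F N (TβOfRecord₁₃ F N) (chiβOfRecord₁₃Ax F N θ.toStage13Params) P.K (gOfRecord₁₃Ax F N θ.toStage13Params P) j)
      (fieldMeasure (F.P P.K) j (SU N)))
    (h11 : ∀ k, k ≤ P.K → ∀ V ∈ domAltOfRecord F N θ.ν P.K k, UkExists F N P.K k θ.εbg V ∧ UniqueUkOrbit F N P.K k θ.εbg V)
    (hres : ∀ k, k ≤ P.K → HRestrict F N θ.εbg P.K k (domAltOfRecord F N θ.ν P.K k))
    (huniq : ∀ k, k ≤ P.K → ∀ V ∈ domAltOfRecord F N θ.ν P.K k, ∀ j < k,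
      UniqueUkOrbit F N P.K (j + 1) θ.εbg (Averaging.iter (avOfRecord F N P.K) (j + 1) (Uk F N P.K k θ.εbg V)))
    (hnestreg : ∀ k, k ≤ P.K → ∀ V ∈ domAltOfRecord F N θ.ν P.K k, ∀ i, i + 1 < k →
      Averaging.iter (avOfRecord F N P.K) (i + 1) (Uk F N P.K k θ.εbg V) ∈
        regSetOfRecord F N P.K i (betaInputOfRecord F N (TβOfRecord₁₃ F N) (chiβOfRecord₁₃Ax F N θ.toStage13Params) P.K (gOfRecord₁₃Ax F N θ.toStage13Params P) i) ∩
          domAltOfRecord F N θ.ν P.K (i + 1)) :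
    (leavesP w P).smallCouplings → (leavesP w P).smallFieldInductive := by
  refine thm3Member_of_indATPlug_of_stepsOn_on (TβOfRecord₁₃ F N) (chiβOfRecord₁₃Ax F N θ.toStage13Params) θ.εbg (betaOfRecord₁₃Ax F N θ.toStage13Params)
    (fun k => domAltOfRecord F N θ.ν P.K k) (fun j => domAltOfRecord F N θ.ν P.K j)
    (fun j => Nat.rec (motive := fun j => Set (GaugeField (F.P P.K) j (SU N))) Set.univ
      (fun i _ => regSetOfRecord F N P.K i
        (betaInputOfRecord F N (TβOfRecord₁₃ F N) (chiβOfRecord₁₃Ax F N θ.toStage13Params) P.K (gOfRecord₁₃Ax F N θ.toStage13Params P) i) ∩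
          domAltOfRecord F N θ.ν P.K (i + 1)) j)
    (by rw [hC]; exact flow_stage13SepCoPHAx F N θ h P) (fun k _ => by rw [hC]; exact indAss_stage13SepCoPHAx_iff F N θ h P k)
    (fun _ _ _ _ => rfl) hχinv ?_ ?_ h11 hres huniq ?_
  · intro j hj
    cases j with
    | zero => exact Filter.Eventually.of_forall fun U _ hU => absurd (Set.mem_univ U) hU
    | succ i => exact hχreg i hj
  · intro j hj hlift
    exact stepOn_TβOfRecord₁₃_of_subset_regSet_inter_of_on F N hj _ (hint j hj) (isOpen_domAltOfRecord θ.ν P.K (j + 1))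
      (fun v V => domAltOfRecord_gaugeAct_mem_iff θ.ν P.K (j + 1) v V) subset_rfl hlift
  · intro k hk V hV j hjk
    cases j with
    | zero => exact Set.mem_univ _
    | succ i => exact hnestreg k hk V hV i hjk

/-- **THE `∀ P` FORM AT THE RE-CENTRED RECORD** = the shape the Ax K1 engine ✓p811182 displays as `h09T …` once `∃ γ₉` is fed `1` (run by run from (M1-dom), (F7a-dom), (I19), [B11] ×3 and
the nesting, all read with the re-centred cut-off `chiβOfRecord₁₃Ax`).  CONDITIONAL; N09 NOT discharged; K1ᴬ NOT closed. [cite: Balaban1987RG1, Thm 3 p.264, (1.1)–(1.3) p.260, (2.1) p.265, (2.9)–(2.10) pp.266–267; Balaban1985Variational, Thm 1 (8)–(10) p.279] -/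
theorem thm3Member_forall_stage13SepCoPHAx_onDomains (θ : Stage13HParams F N) (h : θ.Provisos₁₃SepCoPHAx F N) {w : WorldP}
    (hC : w.C = (datumOfRecord₁₃SepCoPHAx F N θ h).C)
    (hχinv : ∀ (P : B12.RunParams), ∀ j < P.K, ∀ v : GaugeTransf (F.P P.K) (j + 1) (SU N), ∀ᵐ U ∂(fieldMeasure (F.P P.K) j (SU N)),
      (avOfRecord F N P.K j).avg U ∈ domAltOfRecord F N θ.ν P.K (j + 1) →
        chiβOfRecord₁₃Ax F N θ.toStage13Params P.K (gOfRecord₁₃Ax F N θ.toStage13Params P) j (gaugeAct (liftTransf v) U) =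
          chiβOfRecord₁₃Ax F N θ.toStage13Params P.K (gOfRecord₁₃Ax F N θ.toStage13Params P) j U)
    (hχreg : ∀ (P : B12.RunParams) (i : ℕ), i + 1 < P.K → ∀ᵐ U ∂(fieldMeasure (F.P P.K) (i + 1) (SU N)),
      (avOfRecord F N P.K (i + 1)).avg U ∈ domAltOfRecord F N θ.ν P.K (i + 2) →
        U ∉ regSetOfRecord F N P.K i (betaInputOfRecord F N (TβOfRecord₁₃ F N) (chiβOfRecord₁₃Ax F N θ.toStage13Params) P.K (gOfRecord₁₃Ax F N θ.toStage13Params P) i) ∩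
            domAltOfRecord F N θ.ν P.K (i + 1) →
          chiβOfRecord₁₃Ax F N θ.toStage13Params P.K (gOfRecord₁₃Ax F N θ.toStage13Params P) (i + 1) U = 0)
    (hint : ∀ (P : B12.RunParams), ∀ j < P.K, Integrable (betaInputOfRecord F N (TβOfRecord₁₃ F N) (chiβOfRecord₁₃Ax F N θ.toStage13Params) P.K
      (gOfRecord₁₃Ax F N θ.toStage13Params P) j) (fieldMeasure (F.P P.K) j (SU N)))
    (h11 : ∀ (P : B12.RunParams) (k : ℕ), k ≤ P.K → ∀ V ∈ domAltOfRecord F N θ.ν P.K k, UkExists F N P.K k θ.εbg V ∧ UniqueUkOrbit F N P.K k θ.εbg V)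
    (hres : ∀ (P : B12.RunParams) (k : ℕ), k ≤ P.K → HRestrict F N θ.εbg P.K k (domAltOfRecord F N θ.ν P.K k))
    (huniq : ∀ (P : B12.RunParams) (k : ℕ), k ≤ P.K → ∀ V ∈ domAltOfRecord F N θ.ν P.K k, ∀ j < k,
      UniqueUkOrbit F N P.K (j + 1) θ.εbg (Averaging.iter (avOfRecord F N P.K) (j + 1) (Uk F N P.K k θ.εbg V)))
    (hnestreg : ∀ (P : B12.RunParams) (k : ℕ), k ≤ P.K → ∀ V ∈ domAltOfRecord F N θ.ν P.K k, ∀ i, i + 1 < k →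
      Averaging.iter (avOfRecord F N P.K) (i + 1) (Uk F N P.K k θ.εbg V) ∈
        regSetOfRecord F N P.K i (betaInputOfRecord F N (TβOfRecord₁₃ F N) (chiβOfRecord₁₃Ax F N θ.toStage13Params) P.K (gOfRecord₁₃Ax F N θ.toStage13Params P) i) ∩
          domAltOfRecord F N θ.ν P.K (i + 1)) :
    ∀ P : B12.RunParams, (leavesP w P).smallCouplings → (leavesP w P).smallFieldInductive :=
  fun P => thm3Member_stage13SepCoPHAx_onDomains θ h hC P (hχinv P) (hχreg P) (hint P) (h11 P) (hres P) (huniq P) (hnestreg P)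

/-! ## §3. ★ The Ax door v1: (M1-dom) DISCHARGED — no covariance ∕ axiality row at the re-centred record -/

/-- ★ **THE THEOREM-3 MEMBER AT THE RE-CENTRED RECORD FROM (F7a-dom), (I19), [B11] THM 1 AND THE NESTING ALONE** — §2 with its (M1-dom) row fed by the port lane's
`chiβOfRecord₁₃Ax_gaugeAct_liftTransf_ae_on` ([Ax-2] `chiFixed29Ax_gaugeAct_liftTransf`: the re-centred cut-off is lift-invariant at every field whose average lies in the level-`(j+1)` domain,
from [B11] Thm 1's existence + uniqueness there at the cut-off's radius `θ.ν.εreg` — row `h11reg`).  Displayed: `hχreg` ((F7a-dom) a.e.), `hint` (I19), `h11 ∕ hres ∕ huniq` ([B11] ×3 at `θ.εbg`),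
`h11reg` ([B11] Thm 1 at `θ.ν.εreg` on the domains), `hnestreg`.  NO `haxDom`, NO `haxbg`, NO contour data.  CONDITIONAL; N09 NOT discharged; K1ᴬ NOT closed.
[cite: Balaban1987RG1, Thm 3 p.264, (1.1)–(1.3) p.260, (2.1) p.265, (2.9)–(2.10) pp.266–267, (2.16) p.269; Balaban1985Variational, Thm 1 (8)–(10) p.279] -/
theorem thm3Member_forall_stage13SepCoPHAx_onDomains_of_thm1reg (θ : Stage13HParams F N) (h : θ.Provisos₁₃SepCoPHAx F N) {w : WorldP}
    (hC : w.C = (datumOfRecord₁₃SepCoPHAx F N θ h).C)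
    (hχreg : ∀ (P : B12.RunParams) (i : ℕ), i + 1 < P.K → ∀ᵐ U ∂(fieldMeasure (F.P P.K) (i + 1) (SU N)),
      (avOfRecord F N P.K (i + 1)).avg U ∈ domAltOfRecord F N θ.ν P.K (i + 2) →
        U ∉ regSetOfRecord F N P.K i (betaInputOfRecord F N (TβOfRecord₁₃ F N) (chiβOfRecord₁₃Ax F N θ.toStage13Params) P.K (gOfRecord₁₃Ax F N θ.toStage13Params P) i) ∩
            domAltOfRecord F N θ.ν P.K (i + 1) →
          chiβOfRecord₁₃Ax F N θ.toStage13Params P.K (gOfRecord₁₃Ax F N θ.toStage13Params P) (i + 1) U = 0)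
    (hint : ∀ (P : B12.RunParams), ∀ j < P.K, Integrable (betaInputOfRecord F N (TβOfRecord₁₃ F N) (chiβOfRecord₁₃Ax F N θ.toStage13Params) P.K
      (gOfRecord₁₃Ax F N θ.toStage13Params P) j) (fieldMeasure (F.P P.K) j (SU N)))
    (h11 : ∀ (P : B12.RunParams) (k : ℕ), k ≤ P.K → ∀ V ∈ domAltOfRecord F N θ.ν P.K k, UkExists F N P.K k θ.εbg V ∧ UniqueUkOrbit F N P.K k θ.εbg V)
    (h11reg : ∀ (P : B12.RunParams), ∀ j < P.K, ∀ W ∈ domAltOfRecord F N θ.ν P.K (j + 1), UkExists F N P.K (j + 1) θ.ν.εreg W ∧ UniqueUkOrbit F N P.K (j + 1) θ.ν.εreg W)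
    (hres : ∀ (P : B12.RunParams) (k : ℕ), k ≤ P.K → HRestrict F N θ.εbg P.K k (domAltOfRecord F N θ.ν P.K k))
    (huniq : ∀ (P : B12.RunParams) (k : ℕ), k ≤ P.K → ∀ V ∈ domAltOfRecord F N θ.ν P.K k, ∀ j < k,
      UniqueUkOrbit F N P.K (j + 1) θ.εbg (Averaging.iter (avOfRecord F N P.K) (j + 1) (Uk F N P.K k θ.εbg V)))
    (hnestreg : ∀ (P : B12.RunParams) (k : ℕ), k ≤ P.K → ∀ V ∈ domAltOfRecord F N θ.ν P.K k, ∀ i, i + 1 < k →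
      Averaging.iter (avOfRecord F N P.K) (i + 1) (Uk F N P.K k θ.εbg V) ∈
        regSetOfRecord F N P.K i (betaInputOfRecord F N (TβOfRecord₁₃ F N) (chiβOfRecord₁₃Ax F N θ.toStage13Params) P.K (gOfRecord₁₃Ax F N θ.toStage13Params P) i) ∩
          domAltOfRecord F N θ.ν P.K (i + 1)) :
    ∀ P : B12.RunParams, (leavesP w P).smallCouplings → (leavesP w P).smallFieldInductive :=
  thm3Member_forall_stage13SepCoPHAx_onDomains θ h hC
    (fun P => chiβOfRecord₁₃Ax_gaugeAct_liftTransf_ae_on θ.toStage13Params P.K (gOfRecord₁₃Ax F N θ.toStage13Params P) le_rfl (h11reg P))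
    hχreg hint h11 hres huniq hnestreg

/-! ## §4. The Ax K1 engine's `h09T` member shape from §3's rows (`γ₉ := 1`, the window letter idle) -/

/-- **THE Ax ENGINE's `h09T` SHAPE AT ANY `(θ, h)`**: `∃ γ₉ > 0, ∀ w, w.C = (datumOfRecord₁₃SepCoPHAx θ h).C → w.γ ≤ γ₉ → ∀ P, smallCouplings → smallFieldInductive` from §3's rows at `θ` — the
conclusion does not read `w.γ` (`γ₉ := 1`).  Feeding this at `θ := gaussPinH (ofHistoryBlind ⟨θᴬˣ, Zrᴬˣ⟩) χ⋆` discharges the Ax engine ✓p811182's binder `h09T` from §3's seven rows read there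
(a face edition; not done in this file).  CONDITIONAL; N09 NOT discharged. [cite: Balaban1987RG1, Thm 3 p.264, (2.1) p.265, (2.9)–(2.10) pp.266–267; Balaban1985Variational, Thm 1 (8)–(10) p.279] -/
theorem h09T_recordAx_of_rows (θ : Stage13HParams F N) (h : θ.Provisos₁₃SepCoPHAx F N)
    (hχreg : ∀ (P : B12.RunParams) (i : ℕ), i + 1 < P.K → ∀ᵐ U ∂(fieldMeasure (F.P P.K) (i + 1) (SU N)),
      (avOfRecord F N P.K (i + 1)).avg U ∈ domAltOfRecord F N θ.ν P.K (i + 2) →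
        U ∉ regSetOfRecord F N P.K i (betaInputOfRecord F N (TβOfRecord₁₃ F N) (chiβOfRecord₁₃Ax F N θ.toStage13Params) P.K (gOfRecord₁₃Ax F N θ.toStage13Params P) i) ∩
            domAltOfRecord F N θ.ν P.K (i + 1) →
          chiβOfRecord₁₃Ax F N θ.toStage13Params P.K (gOfRecord₁₃Ax F N θ.toStage13Params P) (i + 1) U = 0)
    (hint : ∀ (P : B12.RunParams), ∀ j < P.K, Integrable (betaInputOfRecord F N (TβOfRecord₁₃ F N) (chiβOfRecord₁₃Ax F N θ.toStage13Params) P.K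
      (gOfRecord₁₃Ax F N θ.toStage13Params P) j) (fieldMeasure (F.P P.K) j (SU N)))
    (h11 : ∀ (P : B12.RunParams) (k : ℕ), k ≤ P.K → ∀ V ∈ domAltOfRecord F N θ.ν P.K k, UkExists F N P.K k θ.εbg V ∧ UniqueUkOrbit F N P.K k θ.εbg V)
    (h11reg : ∀ (P : B12.RunParams), ∀ j < P.K, ∀ W ∈ domAltOfRecord F N θ.ν P.K (j + 1), UkExists F N P.K (j + 1) θ.ν.εreg W ∧ UniqueUkOrbit F N P.K (j + 1) θ.ν.εreg W)
    (hres : ∀ (P : B12.RunParams) (k : ℕ), k ≤ P.K → HRestrict F N θ.εbg P.K k (domAltOfRecord F N θ.ν P.K k))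
    (huniq : ∀ (P : B12.RunParams) (k : ℕ), k ≤ P.K → ∀ V ∈ domAltOfRecord F N θ.ν P.K k, ∀ j < k,
      UniqueUkOrbit F N P.K (j + 1) θ.εbg (Averaging.iter (avOfRecord F N P.K) (j + 1) (Uk F N P.K k θ.εbg V)))
    (hnestreg : ∀ (P : B12.RunParams) (k : ℕ), k ≤ P.K → ∀ V ∈ domAltOfRecord F N θ.ν P.K k, ∀ i, i + 1 < k →
      Averaging.iter (avOfRecord F N P.K) (i + 1) (Uk F N P.K k θ.εbg V) ∈
        regSetOfRecord F N P.K i (betaInputOfRecord F N (TβOfRecord₁₃ F N) (chiβOfRecord₁₃Ax F N θ.toStage13Params) P.K (gOfRecord₁₃Ax F N θ.toStage13Params P) i) ∩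
          domAltOfRecord F N θ.ν P.K (i + 1)) :
    ∃ γ₉ : ℝ, 0 < γ₉ ∧ ∀ w : WorldP, w.C = (datumOfRecord₁₃SepCoPHAx F N θ h).C → w.γ ≤ γ₉ →
      ∀ P : B12.RunParams, (leavesP w P).smallCouplings → (leavesP w P).smallFieldInductive :=
  ⟨1, one_pos, fun _ hC _ => thm3Member_forall_stage13SepCoPHAx_onDomains_of_thm1reg θ h hC hχreg hint h11 h11reg hres huniq hnestreg⟩

end Summit.QuantumFields.YangMills.BalabanUVNodes.N09AtRecord13SepCoPHAxOnDomains

end
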